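import Summits.CriticalPhenomena.PercolationContinuityZ3.Theorems.PercNearOneGluingNoHeavyLowerTailFirstHitChargingStar
import Literature.Probability.LatticeModels.ProdBernoulliClusterLocality
import Literature.Probability.LatticeModels.ProdBernoulliIndependence
import Mathlib

/-!
# Crux `PercNearOneGluing.NoHeavyLowerTail` (stmt-CriticalPhenomena-4575), line
`bhk-superadditivity-thinning` — stub `maxPioneerChargingStar` (MAXD for star-attached observers)

File of the crux skeleton (lead prover-line-stmt-CriticalPhenomena-4575-c3-0): proves exactly the
registered stub signature `maxPioneerChargingStar`; lands with
`--supports stmt-CriticalPhenomena-4575`.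

## The theorem

Bond percolation with independent edges on the complete graph `Fin n`, law `μ = prodBernoulli w`.
An observer `o` is attached to a finite relay set `A ∌ o` by the pairs `s(o, a)`, `a ∈ A` (every
other pair at `o` has weight `0`); `b ∈ A` is the target and `r a = μ(a ↮ b)` the (true) budget of a
relay point.  The *pioneer event* of `a ∈ A` is `P a = {o ↔ a inside (↑A)ᶜ ∪ {o, a}}` ("`a` is
joined to `o` by an open path whose interior avoids `A`"), and `a'` *loses to* `a` iff
`r a' < r a ∨ (r a' = r a ∧ a' ≤ a)`.  Then (the hypothesis `MAXD` of the landed reduction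
`manyFingersLargePocket_of_maxPioneerCharging`, for star-attached observers)

`μ(o ↔ A, o ↮ b) ≤ Σ_{a ∈ A} μ(P a ∧ every pioneer a' ∈ A loses to a) · r a`.

## Proof

Three steps after the landed first-hit charging theorem `firstHitChargingStar`, which bounds the
left side by `Σ_a q a (∏_{a' d-beats a} (1 - q a')) r a` with `q a = w s(o, a)` and the priority
"deader first" (`d a = μ(a ↮ b avoiding o)`, ties broken by the index):

1. `maxPC_rearrange` — a deterministic REARRANGEMENT inequality on the finite set `A`: for coins
   `q ∈ [0, 1]`, any injective priority key `ρ` and the value key `σ = (r, index)`,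
   `Σ_a q a (∏_{ρ a < ρ a'} (1 - q a')) r a ≤ Σ_a q a (∏_{σ a < σ a'} (1 - q a')) r a`
   ("the value at the `ρ`-largest open coin is at most the largest open value"; induction peeling
   the `ρ`-top unit, the step being the telescoping identity `maxPC_hitWeight_sum` on the upper
   set of the peeled unit).
2. `maxPC_pioneer_iff` — almost surely (the weight-`0` pairs at `o` are closed), for `a ∈ A` the
   pioneer event `P a` is just `{s(o, a) open}`: the first step of an open path from `o` inside
   `(↑A)ᶜ ∪ {o, a}` is an open pair `s(o, v)`, and `v ∉ A` is excluded.
3. `maxPC_pioneer_real` — hence `μ(P a ∧ ∀ a', P a' → a' loses to a)` is the probability that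
   `s(o, a)` is open and the pairs of the relay points beating `a` are closed, the product
   `q a ∏_{a' beats a} (1 - q a')` (independent coordinates, `prodBernoulli_real_forall_notMem`).
-/

open scoped Classical

namespace Summit.CriticalPhenomena.PercolationContinuityZ3.Theorems

open MeasureTheory
open Literature.Probability.LatticeModels (prodBernoulli)
open Literature.Probability.Percolation

section MaxPioneerChargingStarAux

variable {n : ℕ}

/-- **Telescoping identity for an injective key.**  For coins `q` on a finite set `U` and a key
`σ` injective on `U`, the hit weights "`a` open, every `a'` of larger key closed" sum to
`1 - ∏_{a ∈ U} (1 - q a)` (some coin is open iff there is a key-largest open coin).  Pure algebra.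
[folklore] -/
theorem maxPC_hitWeight_sum {α β : Type*} [LinearOrder β] (σ : α → β) (q : α → ℝ)
    (U : Finset α) (hσ : Set.InjOn σ ↑U) :
    ∑ a ∈ U, q a * ∏ a' ∈ U.filter (fun a' => σ a < σ a'), (1 - q a') =
      1 - ∏ a ∈ U, (1 - q a) := by
  induction U using Finset.induction_on_max_value σ with
  | empty => simp
  | insert t s hts hmax ih =>
    have hlt : ∀ x ∈ s, σ x < σ t := by
      intro x hx
      refine lt_of_le_of_ne (hmax x hx) (fun h => hts ?_)
      have hxt : x = t := hσ (Finset.mem_coe.2 (Finset.mem_insert_of_mem hx))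
        (Finset.mem_coe.2 (Finset.mem_insert_self t s)) h
      exact hxt ▸ hx
    have hft : (insert t s).filter (fun a' => σ t < σ a') = ∅ := by
      refine Finset.filter_false_of_mem (fun a' ha' => ?_)
      rcases Finset.mem_insert.1 ha' with rfl | ha'
      · exact lt_irrefl _
      · exact lt_asymm (hlt a' ha')
    have hsum : ∑ x ∈ s, q x * ∏ a' ∈ (insert t s).filter (fun a' => σ x < σ a'), (1 - q a') =
        (1 - q t) * ∑ x ∈ s, q x * ∏ a' ∈ s.filter (fun a' => σ x < σ a'), (1 - q a') := by
      rw [Finset.mul_sum]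
      refine Finset.sum_congr rfl (fun x hx => ?_)
      rw [Finset.filter_insert, if_pos (hlt x hx),
        Finset.prod_insert (fun h => hts (Finset.mem_filter.1 h).1)]
      ring
    rw [Finset.sum_insert hts, hft, Finset.prod_empty, mul_one, hsum,
      ih (hσ.mono (Finset.coe_subset.2 (Finset.subset_insert t s))), Finset.prod_insert hts]
    ring

/-- **Rearrangement inequality (any priority ≤ maximal charging) on a finite set.**  Coins
`q a ∈ [0, 1]` and values `r a` on a finite set `A`; `ρ` is any key injective on `A` and `σ` a key
injective on `A` along which `r` is monotone.  Then the hit-weighted sum for the priority `ρ`,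
`Σ_a q a (∏_{a' ∈ A, ρ a < ρ a'} (1 - q a')) r a` (the expected value at the `ρ`-largest open
coin), is at most the one for `σ` (the expected largest open value).  Induction peeling the
`ρ`-top unit `m`: both sides satisfy `X(A) = (1 - q m) X(A - m) + q m (…)`, and the step is, on the
upper set `U = {a' | σ m < σ a'}`, the bound `r m ≤ ∏_U (1 - q) r m + Σ_{a ∈ U} (hit weight) r a`
from `maxPC_hitWeight_sum` and `r m ≤ r a` on `U`. [folklore] -/
theorem maxPC_rearrange {α β γ : Type*} [LinearOrder β] [LinearOrder γ] (ρ : α → β) (σ : α → γ)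
    (q r : α → ℝ) (hq0 : ∀ a, 0 ≤ q a) (hq1 : ∀ a, q a ≤ 1) (A : Finset α)
    (hρ : Set.InjOn ρ ↑A) (hσ : Set.InjOn σ ↑A)
    (hσr : ∀ a ∈ A, ∀ a' ∈ A, σ a < σ a' → r a ≤ r a') :
    ∑ a ∈ A, (q a * ∏ a' ∈ A.filter (fun a' => ρ a < ρ a'), (1 - q a')) * r a ≤
      ∑ a ∈ A, (q a * ∏ a' ∈ A.filter (fun a' => σ a < σ a'), (1 - q a')) * r a := by
  induction A using Finset.induction_on_max_value ρ with
  | empty => simp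
  | insert m s hms hmax ih =>
    have ih' := ih (hρ.mono (Finset.coe_subset.2 (Finset.subset_insert m s)))
      (hσ.mono (Finset.coe_subset.2 (Finset.subset_insert m s)))
      (fun a ha a' ha' => hσr a (Finset.mem_insert_of_mem ha) a' (Finset.mem_insert_of_mem ha'))
    have hlt : ∀ x ∈ s, ρ x < ρ m := by
      intro x hx
      refine lt_of_le_of_ne (hmax x hx) (fun h => hms ?_)
      have hxm : x = m := hρ (Finset.mem_coe.2 (Finset.mem_insert_of_mem hx))
        (Finset.mem_coe.2 (Finset.mem_insert_self m s)) h
      exact hxm ▸ hx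
    have hσne : ∀ x ∈ s, σ x ≠ σ m := by
      intro x hx h
      have hxm : x = m := hσ (Finset.mem_coe.2 (Finset.mem_insert_of_mem hx))
        (Finset.mem_coe.2 (Finset.mem_insert_self m s)) h
      exact hms (hxm ▸ hx)
    have hX0 : ∀ (t : Finset α) (a : α), 0 ≤ q a * ∏ a' ∈ t, (1 - q a') :=
      fun t a => mul_nonneg (hq0 a) (Finset.prod_nonneg (fun a' _ => sub_nonneg.2 (hq1 a')))
    -- peeling `m` off the `ρ`-priority side
    have hL : ∑ a ∈ insert m s, (q a * ∏ a' ∈ (insert m s).filter (fun a' => ρ a < ρ a'),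
          (1 - q a')) * r a =
        q m * r m + (1 - q m) *
          ∑ a ∈ s, (q a * ∏ a' ∈ s.filter (fun a' => ρ a < ρ a'), (1 - q a')) * r a := by
      have hfm : (insert m s).filter (fun a' => ρ m < ρ a') = ∅ := by
        refine Finset.filter_false_of_mem (fun a' ha' => ?_)
        rcases Finset.mem_insert.1 ha' with rfl | ha'
        · exact lt_irrefl _
        · exact lt_asymm (hlt a' ha')
      rw [Finset.sum_insert hms, hfm, Finset.prod_empty, mul_one, Finset.mul_sum]
      congr 1
      refine Finset.sum_congr rfl (fun x hx => ?_)
      rw [Finset.filter_insert, if_pos (hlt x hx),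
        Finset.prod_insert (fun h => hms (Finset.mem_filter.1 h).1)]
      ring
    -- peeling `m` off the `σ`-priority side; the upper set of `m` is `s.filter (σ m < σ ·)`
    have hR : ∑ a ∈ insert m s, (q a * ∏ a' ∈ (insert m s).filter (fun a' => σ a < σ a'),
          (1 - q a')) * r a =
        (q m * ∏ a' ∈ s.filter (fun a' => σ m < σ a'), (1 - q a')) * r m +
          ((1 - q m) * ∑ a ∈ s, (q a * ∏ a' ∈ s.filter (fun a' => σ a < σ a'), (1 - q a')) * r a +
            q m * ∑ a ∈ s.filter (fun a' => σ m < σ a'),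
              (q a * ∏ a' ∈ s.filter (fun a' => σ a < σ a'), (1 - q a')) * r a) := by
      have hfm : (insert m s).filter (fun a' => σ m < σ a') = s.filter (fun a' => σ m < σ a') := by
        rw [Finset.filter_insert, if_neg (lt_irrefl _)]
      rw [Finset.sum_insert hms, hfm, Finset.sum_filter, Finset.mul_sum, Finset.mul_sum,
        ← Finset.sum_add_distrib]
      congr 1
      refine Finset.sum_congr rfl (fun x hx => ?_)
      rw [Finset.filter_insert]
      rcases lt_or_gt_of_ne (hσne x hx) with h | h
      · rw [if_pos h, if_neg (lt_asymm h),
          Finset.prod_insert (fun h' => hms (Finset.mem_filter.1 h').1), mul_zero, add_zero]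
        ring
      · have h' : σ m < σ x := h
        rw [if_neg (lt_asymm h'), if_pos h']
        ring
    -- the key estimate on the upper set of `m`
    have hkey : r m ≤ (∏ a' ∈ s.filter (fun a' => σ m < σ a'), (1 - q a')) * r m +
        ∑ a ∈ s.filter (fun a' => σ m < σ a'),
          (q a * ∏ a' ∈ s.filter (fun a' => σ a < σ a'), (1 - q a')) * r a := by
      have hfilt : ∀ a ∈ s.filter (fun a' => σ m < σ a'), s.filter (fun a' => σ a < σ a') =
          (s.filter (fun a' => σ m < σ a')).filter (fun a' => σ a < σ a') := by
        intro a ha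
        have hma : σ m < σ a := (Finset.mem_filter.1 ha).2
        ext x
        simp only [Finset.mem_filter]
        exact ⟨fun ⟨hx, h⟩ => ⟨⟨hx, hma.trans h⟩, h⟩, fun ⟨⟨hx, _⟩, h⟩ => ⟨hx, h⟩⟩
      have hrm : ∀ a ∈ s.filter (fun a' => σ m < σ a'), r m ≤ r a := fun a ha =>
        hσr m (Finset.mem_insert_self m s) a
          (Finset.mem_insert_of_mem (Finset.mem_filter.1 ha).1) (Finset.mem_filter.1 ha).2
      have hw := maxPC_hitWeight_sum σ q (s.filter (fun a' => σ m < σ a'))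
        ((hσ.mono (Finset.coe_subset.2 (Finset.subset_insert m s))).mono
          (Finset.coe_subset.2 (Finset.filter_subset _ s)))
      calc r m = (∏ a' ∈ s.filter (fun a' => σ m < σ a'), (1 - q a')) * r m +
            ∑ a ∈ s.filter (fun a' => σ m < σ a'),
              (q a * ∏ a' ∈ (s.filter (fun a' => σ m < σ a')).filter (fun a' => σ a < σ a'),
                (1 - q a')) * r m := by
            rw [← Finset.sum_mul, hw]
            ring
        _ ≤ (∏ a' ∈ s.filter (fun a' => σ m < σ a'), (1 - q a')) * r m +
            ∑ a ∈ s.filter (fun a' => σ m < σ a'),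
              (q a * ∏ a' ∈ (s.filter (fun a' => σ m < σ a')).filter (fun a' => σ a < σ a'),
                (1 - q a')) * r a :=
            add_le_add le_rfl (Finset.sum_le_sum (fun a ha =>
              mul_le_mul_of_nonneg_left (hrm a ha) (hX0 _ a)))
        _ = (∏ a' ∈ s.filter (fun a' => σ m < σ a'), (1 - q a')) * r m +
            ∑ a ∈ s.filter (fun a' => σ m < σ a'),
              (q a * ∏ a' ∈ s.filter (fun a' => σ a < σ a'), (1 - q a')) * r a := by
            congr 1
            exact Finset.sum_congr rfl (fun a ha => by rw [hfilt a ha])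
    -- assemble
    rw [hL, hR]
    have h1 := mul_le_mul_of_nonneg_left ih' (sub_nonneg.2 (hq1 m))
    have h2 := mul_le_mul_of_nonneg_left hkey (hq0 m)
    linarith

/-- Changing the selecting predicate of a hit weight along a pointwise equivalence (the two
`Finset.filter`s may carry different decidability instances). [folklore] -/
theorem maxPC_summand_congr {α : Type*} {A : Finset α} {p₁ p₂ : α → Prop}
    {i₁ : DecidablePred p₁} {i₂ : DecidablePred p₂} (h : ∀ a' ∈ A, (p₁ a' ↔ p₂ a'))
    (c d : ℝ) (f : α → ℝ) :
    (c * ∏ a' ∈ @Finset.filter α p₁ i₁ A, f a') * d =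
      (c * ∏ a' ∈ @Finset.filter α p₂ i₂ A, f a') * d := by
  rw [Finset.filter_congr h]

/-- "Loses to" is the negation of "beats": for the score `r` with ties broken by the index,
`(r a' < r a ∨ (r a' = r a ∧ a' ≤ a)) ↔ ¬ (r a < r a' ∨ (r a = r a' ∧ a < a'))` (totality of the
lexicographic order on `(r, index)`). [folklore] -/
theorem maxPC_loses_iff {r : Fin n → ℝ} {a a' : Fin n} :
    (r a' < r a ∨ (r a' = r a ∧ a' ≤ a)) ↔ ¬ (r a < r a' ∨ (r a = r a' ∧ a < a')) := by
  have h1 : (r a' < r a ∨ (r a' = r a ∧ a' ≤ a)) ↔ toLex (r a', a') ≤ toLex (r a, a) :=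
    (Prod.Lex.toLex_le_toLex (x := (r a', a')) (y := (r a, a))).symm
  have h2 : (r a < r a' ∨ (r a = r a' ∧ a < a')) ↔ toLex (r a, a) < toLex (r a', a') :=
    (Prod.Lex.toLex_lt_toLex (x := (r a, a)) (y := (r a', a'))).symm
  rw [h1, h2, not_lt]

/-- **A pioneer of a star-attached observer is an open pair.**  If all the pairs `s(o, v)` with
`v ∉ A`, `v ≠ o` are closed in `ω` (and `o ∉ A`), then for `x ∈ A`: `o ↔ x` inside
`(↑A)ᶜ ∪ {o, x}` iff the pair `s(o, x)` is open — the first step of such a path is an open pair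
`s(o, v)` with `v` in the set, `v ∉ A` being excluded, so `v = x`. [folklore] -/
theorem maxPC_pioneer_iff {A : Finset (Fin n)} {o : Fin n} (hoA : o ∉ A) {ω : BondConfig (Fin n)}
    (hω : ∀ v : Fin n, v ∉ A → v ≠ o → s(o, v) ∉ ω) {x : Fin n} (hx : x ∈ A) :
    ω ∈ openConnIn ((↑A : Set (Fin n))ᶜ ∪ {o, x}) o x ↔ s(o, x) ∈ ω := by
  have hox : o ≠ x := fun h => hoA (h ▸ hx)
  constructor
  · rintro ⟨ho, hx', hreach⟩
    obtain ⟨p⟩ := hreach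
    obtain ⟨v, hadj, -, -⟩ := p.exists_eq_cons_of_ne (fun h => hox (congrArg Subtype.val h))
    rw [SimpleGraph.induce_adj, openGraph_adj] at hadj
    rcases (Set.mem_union _ _ _).1 v.2 with hvA | hvox
    · exact absurd hadj.1 (hω v.1 hvA (Ne.symm hadj.2))
    · rcases Set.mem_insert_iff.1 hvox with hvo | hvx
      · exact absurd hvo.symm hadj.2
      · have hvx' : (v : Fin n) = x := Set.mem_singleton_iff.1 hvx
        rw [← hvx']
        exact hadj.1
  · intro he
    have ho : o ∈ (↑A : Set (Fin n))ᶜ ∪ {o, x} := Set.mem_union_right _ (Set.mem_insert o _)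
    have hx' : x ∈ (↑A : Set (Fin n))ᶜ ∪ {o, x} :=
      Set.mem_union_right _ (Set.mem_insert_of_mem o (Set.mem_singleton x))
    refine ⟨ho, hx', SimpleGraph.Adj.reachable ?_⟩
    rw [SimpleGraph.induce_adj, openGraph_adj]
    exact ⟨he, hox⟩

/-- **The selected-pioneer probability of a star-attached observer.**  With `o ∉ A`, `a ∈ A`,
weight `0` on the pairs `s(o, v)`, `v ∉ A`, and any score `r` on the relay points (ties broken by
the index): the event "`a` is a pioneer and every pioneer `a' ∈ A` loses to `a`" has probability
`w s(o, a) · ∏_{a' ∈ A, a' beats a} (1 - w s(o, a'))`.  Indeed it coincides almost surely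
(`maxPC_pioneer_iff`) with "`s(o, a)` open and `s(o, a')` closed for every `a'` beating `a`", whose
probability is computed by `prodBernoulli_real_forall_notMem` (difference of two closed
cylinders). [folklore] -/
theorem maxPC_pioneer_real (w : Sym2 (Fin n) → unitInterval) (A : Finset (Fin n)) (o a : Fin n)
    (r : Fin n → ℝ) (hoA : o ∉ A) (haA : a ∈ A)
    (hw0 : ∀ v : Fin n, v ∉ A → v ≠ o → w s(o, v) = 0) :
    (prodBernoulli w).real {ω : BondConfig (Fin n) |
        ω ∈ openConnIn ((↑A : Set (Fin n))ᶜ ∪ {o, a}) o a ∧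
          ∀ a' ∈ A, ω ∈ openConnIn ((↑A : Set (Fin n))ᶜ ∪ {o, a'}) o a' →
            (r a' < r a ∨ (r a' = r a ∧ a' ≤ a))} =
      ((w s(o, a) : unitInterval) : ℝ) *
        ∏ a' ∈ A.filter (fun a' => r a < r a' ∨ (r a = r a' ∧ a < a')),
          (1 - ((w s(o, a') : unitInterval) : ℝ)) := by
  set F : Finset (Fin n) := A.filter (fun a' => r a < r a' ∨ (r a = r a' ∧ a < a')) with hF
  -- the weight-`0` pairs at `o` are almost surely closed
  have hG : ∀ᵐ ω ∂(prodBernoulli w), ∀ v : Fin n, v ∉ A → v ≠ o → s(o, v) ∉ ω := by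
    refine ae_all_iff.2 (fun v => ?_)
    by_cases hvA : v ∈ A
    · exact Filter.Eventually.of_forall (fun ω h _ => (h hvA).elim)
    · by_cases hvo : v = o
      · exact Filter.Eventually.of_forall (fun ω _ h => (h hvo).elim)
      · filter_upwards [Literature.Probability.LatticeModels.prodBernoulli_ae_notMem w
          (hw0 v hvA hvo)] with ω hω _ _ using hω
  -- the pair map is injective on `A`, and `a` does not beat itself
  have hginj : Set.InjOn (fun x : Fin n => s(o, x)) ↑A := by
    intro x _ y hy h
    rcases Sym2.eq_iff.1 h with ⟨_, h2⟩ | ⟨h2, _⟩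
    · exact h2
    · exact absurd (Finset.mem_coe.1 hy) (h2 ▸ hoA)
  have hginjF : Set.InjOn (fun x : Fin n => s(o, x)) ↑F :=
    hginj.mono (Finset.coe_subset.2 (Finset.filter_subset _ A))
  have hK : s(o, a) ∉ F.image (fun x : Fin n => s(o, x)) := by
    intro h
    obtain ⟨a', ha', he⟩ := Finset.mem_image.1 h
    have ha'a : a' = a :=
      hginj (Finset.mem_coe.2 (Finset.mem_filter.1 ha').1) (Finset.mem_coe.2 haA) he
    rw [ha'a] at ha'
    rcases (Finset.mem_filter.1 ha').2 with h1 | ⟨_, h1⟩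
    · exact lt_irrefl _ h1
    · exact lt_irrefl _ h1
  -- identification of the event, almost surely, with a difference of closed cylinders
  have hae : {ω : BondConfig (Fin n) |
        ω ∈ openConnIn ((↑A : Set (Fin n))ᶜ ∪ {o, a}) o a ∧
          ∀ a' ∈ A, ω ∈ openConnIn ((↑A : Set (Fin n))ᶜ ∪ {o, a'}) o a' →
            (r a' < r a ∨ (r a' = r a ∧ a' ≤ a))} =ᵐ[prodBernoulli w]
      (({ω : Set (Sym2 (Fin n)) | ∀ e ∈ F.image (fun x : Fin n => s(o, x)), e ∉ ω} \
        {ω : Set (Sym2 (Fin n)) | ∀ e ∈ insert s(o, a) (F.image (fun x : Fin n => s(o, x))),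
          e ∉ ω} : Set (Set (Sym2 (Fin n)))) : Set (BondConfig (Fin n))) := by
    refine Filter.eventuallyEq_set.2 (hG.mono (fun ω hω => ?_))
    simp only [Set.mem_setOf_eq, Set.mem_sdiff]
    rw [maxPC_pioneer_iff hoA hω haA]
    constructor
    · rintro ⟨hea, hall⟩
      refine ⟨fun e he => ?_, fun hC => hC _ (Finset.mem_insert_self _ _) hea⟩
      obtain ⟨a', ha'F, rfl⟩ := Finset.mem_image.1 he
      intro he'
      have ha'A : a' ∈ A := (Finset.mem_filter.1 ha'F).1
      have hl := hall a' ha'A ((maxPC_pioneer_iff hoA hω ha'A).2 he')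
      exact (maxPC_loses_iff.1 hl) (Finset.mem_filter.1 ha'F).2
    · rintro ⟨hB, hnC⟩
      refine ⟨?_, fun a' ha'A hP => ?_⟩
      · by_contra hea
        refine hnC (fun e he => ?_)
        rcases Finset.mem_insert.1 he with rfl | he
        · exact hea
        · exact hB e he
      · have he' := (maxPC_pioneer_iff hoA hω ha'A).1 hP
        exact maxPC_loses_iff.2 (fun hb =>
          hB _ (Finset.mem_image_of_mem _ (Finset.mem_filter.2 ⟨ha'A, hb⟩)) he')
  -- the two closed cylinders
  have hsub : {ω : Set (Sym2 (Fin n)) | ∀ e ∈ insert s(o, a) (F.image (fun x : Fin n => s(o, x))),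
        e ∉ ω} ⊆ {ω : Set (Sym2 (Fin n)) | ∀ e ∈ F.image (fun x : Fin n => s(o, x)), e ∉ ω} :=
    fun ω hω e he => hω e (Finset.mem_insert_of_mem he)
  have hCm : MeasurableSet {ω : Set (Sym2 (Fin n)) |
      ∀ e ∈ insert s(o, a) (F.image (fun x : Fin n => s(o, x))), e ∉ ω} :=
    Literature.Probability.LatticeModels.measurableSet_forall_notMem_of_countable
      (T := (↑(insert s(o, a) (F.image (fun x : Fin n => s(o, x)))) : Set (Sym2 (Fin n))))
      (Finset.countable_toSet _)
  have hB : (prodBernoulli w).real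
        {ω : Set (Sym2 (Fin n)) | ∀ e ∈ F.image (fun x : Fin n => s(o, x)), e ∉ ω} =
      ∏ a' ∈ F, (1 - ((w s(o, a') : unitInterval) : ℝ)) := by
    rw [Literature.Probability.LatticeModels.prodBernoulli_real_forall_notMem,
      Finset.prod_image hginjF]
  have hC : (prodBernoulli w).real {ω : Set (Sym2 (Fin n)) |
        ∀ e ∈ insert s(o, a) (F.image (fun x : Fin n => s(o, x))), e ∉ ω} =
      (1 - ((w s(o, a) : unitInterval) : ℝ)) *
        ∏ a' ∈ F, (1 - ((w s(o, a') : unitInterval) : ℝ)) := by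
    rw [Literature.Probability.LatticeModels.prodBernoulli_real_forall_notMem,
      Finset.prod_insert hK, Finset.prod_image hginjF]
  refine (measureReal_congr hae).trans ?_
  refine (measureReal_sdiff hsub hCm).trans ?_
  rw [hB, hC]
  ring

end MaxPioneerChargingStarAux

/-- **MAXD for star-attached observers** (registered stub `maxPioneerChargingStar` of crux
stmt-CriticalPhenomena-4575, line bhk-superadditivity-thinning): the hypothesis shape of the landed
reduction `manyFingersLargePocket_of_maxPioneerCharging`, for an observer `o ∉ A` all of whose
pairs of positive weight lead to the relay set `A ∋ b`.  With `μ = prodBernoulli w`,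
`r x = μ(x ↮ b)`, the pioneer events `P a = {o ↔ a inside (↑A)ᶜ ∪ {o, a}}` and "`a'` loses to `a`"
iff `r a' < r a ∨ (r a' = r a ∧ a' ≤ a)`:
`μ({o ↔ A} ∩ {o ↮ b}) ≤ Σ_{a ∈ A} μ(P a ∧ ∀ a' ∈ A, P a' → a' loses to a) · r a`.
Proof: `firstHitChargingStar` (first-hit charging with true budgets, priority "deader first"),
the rearrangement inequality `maxPC_rearrange` from the deadness priority to the value priority
`(r, index)`, and the identification `maxPC_pioneer_real` of each selected-pioneer probability with
the corresponding hit weight `w s(o, a) ∏_{a' beats a} (1 - w s(o, a'))`. -/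
theorem maxPioneerChargingStar : ∀ (n : ℕ) (w : Sym2 (Fin n) → unitInterval) (A : Finset (Fin n)) (o b : Fin n), b ∈ A → o ∉ A → (∀ v : Fin n, v ∉ A → v ≠ o → w s(o, v) = 0) → (Literature.Probability.LatticeModels.prodBernoulli w).real ((⋃ a ∈ A, Literature.Probability.Percolation.openConn o a) ∩ (Literature.Probability.Percolation.openConn o b)ᶜ) ≤ ∑ a ∈ A, (Literature.Probability.LatticeModels.prodBernoulli w).real {ω : Literature.Probability.Percolation.BondConfig (Fin n) | ω ∈ Literature.Probability.Percolation.openConnIn ((↑A : Set (Fin n))ᶜ ∪ {o, a}) o a ∧ ∀ a' ∈ A, ω ∈ Literature.Probability.Percolation.openConnIn ((↑A : Set (Fin n))ᶜ ∪ {o, a'}) o a' → ((Literature.Probability.LatticeModels.prodBernoulli w).real (Literature.Probability.Percolation.openConn a' b)ᶜ < (Literature.Probability.LatticeModels.prodBernoulli w).real (Literature.Probability.Percolation.openConn a b)ᶜ ∨ ((Literature.Probability.LatticeModels.prodBernoulli w).real (Literature.Probability.Percolation.openConn a' b)ᶜ = (Literature.Probability.LatticeModels.prodBernoulli w).real (Literature.Probability.Percolation.openConn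 a b)ᶜ ∧ a' ≤ a))} * (Literature.Probability.LatticeModels.prodBernoulli w).real (Literature.Probability.Percolation.openConn a b)ᶜ := by
  intro n w A o b hbA hoA hw0
  refine (firstHitChargingStar n w A o b hbA hoA hw0).trans ?_
  -- the two priorities as injective lexicographic keys
  have hinjρ : Set.InjOn (fun a : Fin n => toLex ((prodBernoulli w).real
      (openConnIn (({o} : Set (Fin n))ᶜ) a b)ᶜ, a)) ↑A :=
    fun a _ a' _ h => congrArg Prod.snd (toLex.injective h)
  have hinjσ : Set.InjOn (fun a : Fin n => toLex ((prodBernoulli w).real (openConn a b)ᶜ, a)) ↑A :=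
    fun a _ a' _ h => congrArg Prod.snd (toLex.injective h)
  have hmono : ∀ a ∈ A, ∀ a' ∈ A,
      toLex ((prodBernoulli w).real (openConn a b)ᶜ, a) <
        toLex ((prodBernoulli w).real (openConn a' b)ᶜ, a') →
      (prodBernoulli w).real (openConn a b)ᶜ ≤ (prodBernoulli w).real (openConn a' b)ᶜ := by
    intro a _ a' _ h
    rcases (Prod.Lex.toLex_lt_toLex (x := (_, a)) (y := (_, a'))).1 h with h' | ⟨h', _⟩
    · exact le_of_lt h'
    · exact le_of_eq h'
  have key := maxPC_rearrange
    (fun a : Fin n => toLex ((prodBernoulli w).real (openConnIn (({o} : Set (Fin n))ᶜ) a b)ᶜ, a))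
    (fun a : Fin n => toLex ((prodBernoulli w).real (openConn a b)ᶜ, a))
    (fun a => ((w s(o, a) : unitInterval) : ℝ)) (fun a => (prodBernoulli w).real (openConn a b)ᶜ)
    (fun a => unitInterval.nonneg _) (fun a => unitInterval.le_one _) A hinjρ hinjσ hmono
  beta_reduce at key
  refine le_of_eq_of_le ?_ (key.trans_eq ?_)
  · exact Finset.sum_congr rfl (fun a ha => maxPC_summand_congr
      (fun a' _ => (Prod.Lex.toLex_lt_toLex (x := (_, a)) (y := (_, a'))).symm) _ _ _)
  · refine Finset.sum_congr rfl (fun a ha => ?_)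
    rw [maxPC_pioneer_real w A o a (fun x => (prodBernoulli w).real (openConn x b)ᶜ) hoA ha hw0]
    exact maxPC_summand_congr
      (fun a' _ => Prod.Lex.toLex_lt_toLex (x := (_, a)) (y := (_, a'))) _ _ _

end Summit.CriticalPhenomena.PercolationContinuityZ3.Theorems
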